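import Mathlib
import HarnessLib
import HarnessLib.Audit
import Summits.AtomisticToContinuum.Statement
import Literature.MathematicalPhysics.KineticTheory.InfiniteChainDynamics
import Literature.MathematicalPhysics.KineticTheory.LangevinChainNESS
import Literature.MathematicalPhysics.KineticTheory.LangevinChainNESSHolds
import Summits.AtomisticToContinuum.FouriersLaw.Theorems.FourierGreenKuboAssembly
import Summits.AtomisticToContinuum.FouriersLaw.Theorems.EmbeddedDrudeMourreNessUnique
import HarnessLib.Audit.Status.Attr

/-!
Route: FourierGreenKubo

DORMANT since 2026-08-22T08:23:59Z (reconciler: no traction for 5.2 d (last activity item-evidence-added at 2026-08-17T02:55:39Z); parked, not closed — `ledger route dormant route-AtomisticToContinuum-FourierGreenKubo --off` to reactiva) — unstaffed, not closed; items shared with open routes are served there. `ledger route dormant <id> --off` reactivates.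

X_F (LINEAR RESPONSE / GREEN–KUBO LINE): for the pinned anharmonic chain pinnedChain ω₂ lam β γ (all
four
parameters > 0) and every temperature T > 0:
 (i)   [formal] for every N and T_L, T_R > 0 the weak stationary Fokker–Planck state (IsSteadyState)
exists and is
       unique;
 (ii)  [formal, existence part] for every N the finite-volume linear-response coefficient
       D_N(T) = lim_{δ→0} totalCurrent(μ_{N,T+δ/2,T−δ/2})/δ exists — and (informal part) equals the
finite-volume
       Kubo formula D_N(T) = (γ-dependent boundary form) = T⁻² ∫_0^∞ Σ_{i} E_{N,T}[ j_bd(0) j_i(t) ]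
dt for the
       equilibrium (T_L = T_R = T) Langevin chain (Gibbs ⊗ bath-invariant), j_bd the bath energy
current;
 (iii) [informal; needs infinite-volume dynamics] GREEN–KUBO: for the infinite pinned chain
(Hamiltonian dynamics on
       ℤ, Gibbs measure at temperature T, which is invariant) the total current autocorrelation
       C_T(t) = Σ_{x∈ℤ} ⟨ j_0(0) ; j_x(t) ⟩_T is absolutely integrable on [0, ∞) and
       κ_GK(T) := T⁻² ∫_0^∞ C_T(t) dt satisfies 0 < κ_GK(T) < ∞;
 (iv)  [informal] D_N(T) → κ_GK(T) as N → ∞ (boundary layers at the baths contribute o(1) after the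
factor N is
       absorbed by totalCurrent = (N−1)·J̃).
Then X_F := (i) ∧ (ii) ∧ (iii) ∧ (iv) ⇒ FouriersLawFor (pinnedChain ω₂ lam β γ) with κ = κ_GK, for
all parameters
⇒ FouriersLaw.
Lean shape of the assembly (elaborates; (iii),(iv) enter through the ∃ κ, ∃ D clause):
  (∀ params > 0, ∀ N T_L T_R > 0, ∃! steady state)  →  (∀ params > 0, ∃ κ > 0 on (0,∞), ∀
steady-state families μ,
   ∀ T > 0, ∃ D : ℕ → ℝ, (∀ N, Tendsto (δ ↦ totalCurrent (μ N (T+δ/2) (T−δ/2)) / δ) (𝓝[≠] 0) (𝓝 (D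
N))) ∧
   Tendsto D atTop (𝓝 (κ T)))  →
Literature.MathematicalPhysics.KineticTheory.HeatConduction.FouriersLaw        [exact term filed as
rank-1 item].

Rationale: WHY THIS LINE. BLR's statement (33) takes δT → 0 FIRST at fixed N: that limit is linear response of
a
finite-dimensional hypoelliptic diffusion around its EQUILIBRIUM (T_L = T_R = T, where the invariant
measure is the
explicit Gibbs state), so the nonequilibrium problem reduces to (a) smooth dependence of the NESS on
the bath
temperatures — a theorem-schema for hypoelliptic SDEs with Lyapunov structure (Hairer–Majda
arXiv:0909.4313,
"A simple framework to justify linear response theory"; NESS existence/uniqueness/Lyapunov: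
ReyBelletThomas2002,
Carmona2007, CuneoEckmannHairerReyBellet2018 Thm 2.13) — and (b) an EQUILIBRIUM DYNAMICS problem:
time-decay of
current–current correlations of the infinite anharmonic chain (Green–Kubo). (b) is where the open
difficulty is
concentrated and where other areas enter: hypocoercivity/spectral theory of the Liouvillian on
L²(Gibbs),
probabilistic CLT/martingale methods (proved when a stochastic energy-conserving bulk noise is
added:
Bernardin–Olla 2005 doi:10.1007/s10955-005-7578-9; BonettoLebowitzReyBellet2000 §6), kinetic theory
of phonons
at weak anharmonicity (AokiLukkarinenSpohn2006; Bricmont–Kupiainen arXiv:math-ph/0605062 closure).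
No physical
analogy is used; the dictionary NESS-current ↔ equilibrium time-correlation is the Kubo formula
itself, filed as
crux (ii)/(iv). Not chosen as a route: the perturbative phonon-Boltzmann line alone (it cannot give
the conjunct's
∀ lam, β > 0) and entropy-production bounds (give κ_N upper bounds only).

RANKED CRUXES:
 2. (iii) Green–Kubo integrability and positivity for the infinite pinned FPU-β + φ⁴-pinned chain at
every T > 0
    [informal; definition requests: infinite-chain dynamics + κ_GK]. Open for every deterministic
anharmonic chain.
 3. (iv) D_N(T) → κ_GK(T) [informal]: finite-volume Kubo formula → infinite-volume GK; needs
uniform-in-N decay.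
 4. (ii) existence of D_N [formal]: differentiability of δ ↦ μ_{N,T+δ/2,T−δ/2}(j_i) at δ = 0 for the
pinned
    chain (Hairer–Majda hypotheses: hypoellipticity, polynomial Lyapunov function, integrable
currents).
 5. (i) NESS existence and uniqueness in the weak Fokker–Planck class [formal]: CEHR2018 Thm 2.13 /
Carmona2007
    give the invariant measure; plus "weak stationary probability solution with integrable currents
= invariant
    measure" (hypoelliptic regularity + Echeverría/well-posed martingale problem). Expected to close
from
    Literature facts; it also de-vacuifies (ii).
KILL CRITERIA: a proof that C_T ∉ L¹ (κ = ∞, anomalous transport despite pinning) or κ_GK(T) = 0 for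
some
admissible parameters refutes (iii) AND, via (ii)+(iv) if those hold, the conjunct FouriersLaw
itself → file
¬FouriersLaw. Refutation of (i) (non-uniqueness of weak steady states in the integrable-current
class) refutes the
conjunct as formalised (its clause (i)).
NOT DECOMPOSED: the proof strategy for (iii) (hypocoercive resolvent estimates vs. renormalised
phonon kinetic
theory vs. coupling to a stochastic model), boundary-layer analysis in (iv), T-dependence/continuity
of κ.
SOURCES: BonettoLebowitzReyBellet2000 §5–6, §10; Hairer–Majda arXiv:0909.4313;
CuneoEckmannHairerReyBellet2018
Thm 2.13; ReyBelletThomas2002; Carmona2007; HairerMattingly2009; Bernardin–Olla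
doi:10.1007/s10955-005-7578-9;
Bricmont–Kupiainen arXiv:math-ph/0605062; AokiLukkarinenSpohn2006.

Novelty: NOVELTY (retriage pass 2026-08-14; searches run: `lit frontier AtomisticToContinuum --since 2020`,
`lit bridges
AtomisticToContinuum --cross any`, `lit search --hybrid "Green-Kubo formula thermal conductivity
anharmonic chain
linear response steady state heat baths"`, `lit search "Green-Kubo formula heat conduction
anharmonic oscillators
chain rigorous thermal conductivity" --source all` (OpenAlex/S2/arXiv rate-limited; crossref +
local), `lit search
--source local` for "Green-Kubo formula for heat conduction in open systems" and "Heat equation from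
a deterministic
dynamics", `lit vsearch` for the Echeverría/stationary-martingale bridge, `lit read` arXiv:0809.4543
pp.1-2,
arXiv:0808.3256 pp.9,40, arXiv:2310.13338 pp.1-5,11, doi:10.1007/bf01152283 pp.6-9, `lean search
--decl` on every
decl named below).
Nearest prior art — this route IS the mainstream linear-response / Green–Kubo programme in BLR's own
formulation:
- BonettoLebowitzReyBellet2000 §5.2 (32), §5.3 (κ := lim_L L·lim_{δT→0} μ(Φ)/(AδT), the shape of
FouriersLawFor;
  "it is the limit L→∞ which is the crux of the matter"), §6.3 (34)–(36), §7 (37) (κ_GK; "not even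
clear how to
  prove … κ = κ_GK"): thesis (i)–(iv) is exactly this chain of definitions with δT → 0 taken first.
- Finite-volume Kubo formula: ReyBellet2003 Rem 4.4 (56); ReyBellet2006 (LNM 1881) Thm 4.1(c)
(theorem, RBT
  reservoirs); for white-noise Langevin baths at physics level KunduDharNarayan2009
(arXiv:0809.4543: "an exact
  Green–Kubo type linear re  [refs: 10.1007/bf01152283, 0809.4543, 0808.3256, 2310.13338, doi:10.1007/bf01152283, BonettoLebowitzReyBellet2000, ReyBellet2003, ReyBellet2006, KunduDharNarayan2009, Dhar2008, LanfordLebowitzLieb1977, BernardinOlla2005, Bernardin2014, CanestrariLiveraniOlla2026, HairerMajda2009, CuneoEckmannHairerReyBellet2018, Carmona2007]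

Barriers (technique_class: linear-response green-kubo correlation-decay thermo-limit): BARRIERS (catalogue Literature/Barriers/AtomisticToContinuum/, all ten FouriersLaw entries checked
against technique_class
"linear-response green-kubo correlation-decay thermo-limit" = linear response at fixed N +
infinite-volume equilibrium
current-correlation decay + thermodynamic limit; Lean decls live in namespace
Literature.Barriers.AtomisticToContinuum unless stated):
- Literature.Barriers.AtomisticToContinuum.Mazur1969_inequality (MazurBoundBallistic;
green-kubo/current-autocorrelation-decay/
  conservation-law-blind): APPLIES to crux GreenKubo — a conserved Q of the infinite pinned chain
with ⟨JQ⟩_T ≠ 0 forces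
  ∫₀^τ C_T → ∞ linearly (Mazur1969_inequality.tendsto_integral_atTop), i.e. C_T ∉ L¹. Evasion =
entry's evasion (i): the
  on-site potential (ω₂, lam > 0) removes momentum conservation (⟨JP⟩-mechanism void) and the
quartic U+V chain is believed
  non-integrable; but absence of further local conserved quantities overlapping J is UNPROVED — any
proof of GreenKubo must
  exclude them, and a found Q is the route's recorded kill criterion (file ¬GreenKubo).
- Literature.Barriers.AtomisticToContinuum.HasBoundedResponse (FixedLengthNoConductivityControl;
  hasBoundedResponse_of_fouriersLawFor PROVED): APPLIES squarely to crux ThermodynamicLimit — every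
fixed-N tool the route
  owns (CEHR2018 Thm 2.13, Carmona2007, HairerMajda2009, finite-volume Kubo formula) is silent on
N-dependence ("Nothing
  is known about the dependence of D on L", BLR2000 §6.3). Not evaded: the r

History (route lifecycle, newest last):
- 2026-08-16T14:43:06Z · LINT AUTOFIX route.multi-assembly: kept Assembly, dropped Assembly2, Assembly3 (gate:hygiene)
- 2026-08-22T08:23:59Z · DORMANT — reconciler: no traction for 5.2 d (last activity item-evidence-added at 2026-08-17T02:55:39Z); parked, not closed — `ledger route dormant route-AtomisticToConti (operator:999:916295)

sub-problem: FouriersLaw · status: dormant · opened planner-AtomisticToContinuum-Survey-0 2026-08-13T13:27:26Z · rev 6 · ledger route-AtomisticToContinuum-FourierGreenKubo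
GENERATED by the gate from the ledger (D-0016/17). Provers cite these decls: `theorem foo : Summit.AtomisticToContinuum.FouriersLaw.Theses.FourierGreenKubo.<Decl> := …` in Summits/AtomisticToContinuum/FouriersLaw/Theorems/<Name>.lean.
-/

namespace Summit.AtomisticToContinuum.FouriersLaw.Theses.FourierGreenKubo

open scoped BigOperators Topology Manifold Classical MeasureTheory ProbabilityTheory Matrix InnerProductSpace ComplexConjugate ContinuousMap
open Filter Set Function TopologicalSpace MeasureTheory

attribute [summit_statement] _root_.FouriersLaw

/-- item stmt-AtomisticToContinuum-0701 · target · rank 0 · open · by planner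
why it might fail: Inherits both cruxes: C_T∈L¹ with κ_GK>0 (GreenKubo) and D_N→κ_GK (ThermodynamicLimit); κ=κ_GK may fail for boundary-driven chains even with normal bulk transport (BLR2000 §7, Dhar2008 §9(e)). As typed the frame equals Assembly2 and is already proved in tree, so all risk sits in the two cruxes.
sources: BonettoLebowitzReyBellet2000 §7 (37), Dhar2008 (arXiv:0808.3256) §9(e) p.40, decl Literature.HeatConduction.fouriersLaw_of_ness_greenKubo_thermodynamicLimit (proves the typed frame = Assembly2)
X_F: for pinnedChain ω₂ lam β γ (all > 0) and every T > 0: (i) weak steady state exists and is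
unique for all N, T_L, T_R > 0; (ii) the finite-N linear-response coefficient D_N(T) = lim_{δ→0}
totalCurrent(μ_{N,T+δ/2,T−δ/2})/δ exists and equals the finite-volume equilibrium Kubo formula;
(iii) Green–Kubo: for the infinite chain in the Gibbs state at T, C_T(t) = Σ_x ⟨j_0(0); j_x(t)⟩_T ∈
L¹([0,∞)) and κ_GK(T) = T⁻² ∫_0^∞ C_T > 0; (iv) D_N(T) → κ_GK(T). Then FouriersLawFor (pinnedChain
…) holds with κ = κ_GK, hence FouriersLaw. -/
@[route_item "route-AtomisticToContinuum-FourierGreenKubo"]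
def FourierGkThesis : Prop :=
  (∀ ω₂ lam β γ : ℝ, 0 < ω₂ → 0 < lam → 0 < β → 0 < γ → ∀ (N : ℕ) (T_L T_R : ℝ), 0 < T_L → 0 < T_R → ∃ μ : MeasureTheory.Measure (Literature.MathematicalPhysics.KineticTheory.HeatConduction.PhaseSpace N), (Literature.MathematicalPhysics.KineticTheory.HeatConduction.pinnedChain ω₂ lam β γ).IsSteadyState N T_L T_R μ ∧ ∀ ν : MeasureTheory.Measure (Literature.MathematicalPhysics.KineticTheory.HeatConduction.PhaseSpace N), (Literature.MathematicalPhysics.KineticTheory.HeatConduction.pinnedChain ω₂ lam β γ).IsSteadyState N T_L T_R ν → ν = μ) → (∀ ω₂ lam β γ : ℝ, 0 < ω₂ → 0 < lam → 0 < β → 0 < γ → ∀ T : ℝ, 0 < T → ∃ μ : MeasureTheory.Measure Literature.MathematicalPhysics.KineticTheory.HeatConduction.ChainConfig, (Literature.MathematicalPhysics.KineticTheory.HeatConduction.pinnedChain ω₂ lam β γ).IsChainGibbsMeasure T μ ∧ ∃ D : Literature.MathematicalPhysics.KineticTheory.HeatConduction.InfiniteChainDynamics (Literature.MathematicalPhysics.KineticTheory.HeatConduction.pinnedChain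 ω₂ lam β γ), D.PreservesMeasure μ ∧ D.HasGreenKubo μ T) → (∀ ω₂ lam β γ : ℝ, 0 < ω₂ → 0 < lam → 0 < β → 0 < γ → (∀ (N : ℕ) (T_L T_R : ℝ), 0 < T_L → 0 < T_R → ∀ μ ν : MeasureTheory.Measure (Literature.MathematicalPhysics.KineticTheory.HeatConduction.PhaseSpace N), (Literature.MathematicalPhysics.KineticTheory.HeatConduction.pinnedChain ω₂ lam β γ).IsSteadyState N T_L T_R μ → (Literature.MathematicalPhysics.KineticTheory.HeatConduction.pinnedChain ω₂ lam β γ).IsSteadyState N T_L T_R ν → μ = ν) → ∀ μ : (N : ℕ) → ℝ → ℝ → MeasureTheory.Measure (Literature.MathematicalPhysics.KineticTheory.HeatConduction.PhaseSpace N), (∀ (N : ℕ) (T_L T_R : ℝ), 0 < T_L → 0 < T_R → (Literature.MathematicalPhysics.KineticTheory.HeatConduction.pinnedChain ω₂ lam β γ).IsSteadyState N T_L T_R (μ N T_L T_R)) → ∀ T : ℝ, 0 < T → ∀ (μT : MeasureTheory.Measure Literature.MathematicalPhysics.KineticTheory.HeatConduction.ChainConfig) (D : Literature.MathematicalPhysics.KineticTheory.HeatConduction.InfiniteChainDynamics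 (Literature.MathematicalPhysics.KineticTheory.HeatConduction.pinnedChain ω₂ lam β γ)), (Literature.MathematicalPhysics.KineticTheory.HeatConduction.pinnedChain ω₂ lam β γ).IsChainGibbsMeasure T μT → D.PreservesMeasure μT → D.HasGreenKubo μT T → ∃ Dn : ℕ → ℝ, (∀ N : ℕ, Filter.Tendsto (fun δ : ℝ => (Literature.MathematicalPhysics.KineticTheory.HeatConduction.pinnedChain ω₂ lam β γ).totalCurrent (μ N (T + δ / 2) (T - δ / 2)) / δ) (nhdsWithin 0 {(0 : ℝ)}ᶜ) (nhds (Dn N))) ∧ Filter.Tendsto Dn Filter.atTop (nhds (D.greenKuboConductivity μT T))) → Literature.MathematicalPhysics.KineticTheory.HeatConduction.FouriersLaw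

/-- item stmt-AtomisticToContinuum-0703 · crux · rank 2 · open · by planner
why it might fail: C_T∈L¹ is unproved for any deterministic anharmonic lattice; by the scaling conjugacy low T is the harmonic corner (κ_GK~(λT)⁻²), so no (lam,β)-perturbative or T-uniform bound works; a hidden conserved Q with ⟨JQ⟩≠0 gives C_T a positive Cesàro mean (Mazur); breathers may leave a non-L¹ tail.
sources: BonettoLebowitzReyBellet2000 §6.3 p.12, §7 (37) p.13, Bernardin2014 (arXiv:1407.7023) p.8 and Thm 5 p.11 (GK only with velocity-flip noise), CanestrariLiveraniOlla2026 (arXiv:2310.13338) §1 p.3 'even the proof of the existence of the thermal diffusivity D is missing', AokiLukkarinenSpohn2006 §3 (3.25)-(3.28), LanfordLebowitzLieb1977 Thm 3 p.7, Thm 4 p.9 (a.e. flow, uniqueness class; hidden infrastructure of ∃D), LepriLiviPoliti2003 §8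
GREEN–KUBO FOR THE INFINITE PINNED ANHARMONIC CHAIN: let U(q) = ω₂q²/2 + lam q⁴/4, V(r) = r²/2 +
βr⁴/4 (ω₂, lam, β > 0). For every T > 0: the infinite-volume Hamiltonian dynamics on tempered
configurations of ℝ^ℤ × ℝ^ℤ exists and preserves the (unique) Gibbs measure μ_T; with bond current
j_x = −½(p_x + p_{x+1})V′(q_{x+1} − q_x), the summed autocorrelation C_T(t) := Σ_{x∈ℤ} E_{μ_T}[
j_0(0) j_x(t) ] converges absolutely for each t, t ↦ C_T(t) is in L¹([0,∞)), and κ_GK(T) := T⁻²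
∫_0^∞ C_T(t) dt satisfies 0 < κ_GK(T) < ∞. (Open for every deterministic anharmonic lattice model;
with energy-conserving bulk noise: Bernardin–Olla 2005.) -/
@[route_item "route-AtomisticToContinuum-FourierGreenKubo", crux]
def FourierGreenKubo : Prop :=
  ∀ ω₂ lam β γ : ℝ, 0 < ω₂ → 0 < lam → 0 < β → 0 < γ → ∀ T : ℝ, 0 < T → ∃ μ : MeasureTheory.Measure Literature.MathematicalPhysics.KineticTheory.HeatConduction.ChainConfig, (Literature.MathematicalPhysics.KineticTheory.HeatConduction.pinnedChain ω₂ lam β γ).IsChainGibbsMeasure T μ ∧ ∃ D : Literature.MathematicalPhysics.KineticTheory.HeatConduction.InfiniteChainDynamics (Literature.MathematicalPhysics.KineticTheory.HeatConduction.pinnedChain ω₂ lam β γ), D.PreservesMeasure μ ∧ D.HasGreenKubo μ T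

/-- item stmt-AtomisticToContinuum-0742 · crux · rank 3 · open · by planner
why it might fail: Needs N-uniform decay of equilibrium current correlations of the end-thermostatted chain + o(1) boundary layers: the spectral gap closes (λ_S≤γ/N, Becker–Menegaki), open- vs closed-system correlations can scale differently (Dhar2008 §2.2), even a formal argument for κ=κ_GK is lacking (BLR2000 §7).
sources: BonettoLebowitzReyBellet2000 §5.3 p.10 ('the limit L→∞ is the crux of the matter'), §7 after (37) p.13, Dhar2008 (arXiv:0808.3256) §2.2 p.9, §9(e) p.40 (poses exactly this equivalence as open), KunduDharNarayan2009 (arXiv:0809.4543) open-system Green–Kubo formula for the Langevin-bath lattice, ReyBellet2003 Rem 4.4 (56); ReyBellet2006 Thm 4.1(c), BeckerMenegaki2022 Thm 1, Prop 2.2(3) / decl Literature.Barriers.AtomisticToContinuum.BeckerMenegaki2022_gapClosing, decl Literature.Barriers.AtomisticToContinuum.HasBoundedResponse + hasBoundedResponse_of_fouriersLawFor (FixedLengthNoConductivityControl)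
[crux] THERMODYNAMIC LIMIT OF THE RESPONSE COEFFICIENT, WITNESS FORM (supersedes
stmt-AtomisticToContinuum-0704; refuters g12-0/1/2/3/5: the ∀(μ_T,D) form hid the claim that κ_GK is
the same for every DLR state and every dynamics). Under weak-NESS uniqueness and T > 0, IF some
Gibbs state with a μ_T-preserving Green–Kubo dynamics exists (hypothesis = GreenKubo at T), THEN
there is such a pair (μ_T, D), fixed before the steady-state family is chosen, such that for every
steady-state family μ and every sequence Dn of finite-volume response coefficients (Dn N =
lim_{δ→0,δ≠0} totalCurrent(μ N (T+δ/2) (T−δ/2))/δ, existence = FiniteResponse, uniqueness of limits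
makes Dn canonical) one has Dn → greenKuboConductivity D μ_T T. Content: finite-volume Kubo formula
(ReyBellet2003 Rem 4.4 (56)) + N-uniform decay of equilibrium current correlations of the Langevin
chain + o(1) boundary layers at the baths; open (BonettoLebowitzReyBellet2000 §7 after (37)). N = 0,
1: Dn = 0, irrelevant to atTop. -/
@[route_item "route-AtomisticToContinuum-FourierGreenKubo", crux]
def ThermodynamicLimit : Prop :=
  ∀ ω₂ lam β γ : ℝ, 0 < ω₂ → 0 < lam → 0 < β → 0 < γ → (∀ (N : ℕ) (T_L T_R : ℝ), 0 < T_L → 0 < T_R → ∀ μ ν : MeasureTheory.Measure (Literature.MathematicalPhysics.KineticTheory.HeatConduction.PhaseSpace N), (Literature.MathematicalPhysics.KineticTheory.HeatConduction.pinnedChain ω₂ lam β γ).IsSteadyState N T_L T_R μ → (Literature.MathematicalPhysics.KineticTheory.HeatConduction.pinnedChain ω₂ lam β γ).IsSteadyState N T_L T_R ν → μ = ν) → ∀ T : ℝ, 0 < T → (∃ μT : MeasureTheory.Measure Literature.MathematicalPhysics.KineticTheory.HeatConduction.ChainConfig, (Literature.MathematicalPhysics.KineticTheory.HeatConduction.pinnedChain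 ω₂ lam β γ).IsChainGibbsMeasure T μT ∧ ∃ D : Literature.MathematicalPhysics.KineticTheory.HeatConduction.InfiniteChainDynamics (Literature.MathematicalPhysics.KineticTheory.HeatConduction.pinnedChain ω₂ lam β γ), D.PreservesMeasure μT ∧ D.HasGreenKubo μT T) → ∃ (μT : MeasureTheory.Measure Literature.MathematicalPhysics.KineticTheory.HeatConduction.ChainConfig) (D : Literature.MathematicalPhysics.KineticTheory.HeatConduction.InfiniteChainDynamics (Literature.MathematicalPhysics.KineticTheory.HeatConduction.pinnedChain ω₂ lam β γ)), (Literature.MathematicalPhysics.KineticTheory.HeatConduction.pinnedChain ω₂ lam β γ).IsChainGibbsMeasure T μT ∧ D.PreservesMeasure μT ∧ D.HasGreenKubo μT T ∧ ∀ μ : (N : ℕ) → ℝ → ℝ → MeasureTheory.Measure (Literature.MathematicalPhysics.KineticTheory.HeatConduction.PhaseSpace N), (∀ (N : ℕ) (T_L T_R : ℝ), 0 < T_L → 0 < T_R → (Literature.MathematicalPhysics.KineticTheory.HeatConduction.pinnedChain ω₂ lam β γ).IsSteadyState N T_L T_R (μ N T_L T_R)) → ∀ Dn : ℕ → ℝ,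 (∀ N : ℕ, Filter.Tendsto (fun δ : ℝ => (Literature.MathematicalPhysics.KineticTheory.HeatConduction.pinnedChain ω₂ lam β γ).totalCurrent (μ N (T + δ / 2) (T - δ / 2)) / δ) (nhdsWithin 0 {(0 : ℝ)}ᶜ) (nhds (Dn N))) → Filter.Tendsto Dn Filter.atTop (nhds (D.greenKuboConductivity μT T))

/-- item stmt-AtomisticToContinuum-0704 · support · rank 3 · open · by planner
THERMODYNAMIC LIMIT OF THE RESPONSE COEFFICIENT: for pinnedChain ω₂ lam β γ (all > 0), T > 0, and
the unique steady states μ_{N,T_L,T_R}: the finite-N coefficient D_N(T) (which by the finite-volume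
Kubo formula is an equilibrium time-correlation integral of the Langevin chain at temperature T
involving the bath currents and Σ_i j_i) converges as N → ∞ to κ_GK(T) of the Green–Kubo item.
Requires decay of equilibrium correlations uniform in N and control of the O(1) boundary layers at
the two baths. -/
@[route_item "route-AtomisticToContinuum-FourierGreenKubo"]
def FourierDNToGK : Prop :=
  ∀ ω₂ lam β γ : ℝ, 0 < ω₂ → 0 < lam → 0 < β → 0 < γ → (∀ (N : ℕ) (T_L T_R : ℝ), 0 < T_L → 0 < T_R → ∀ μ ν : MeasureTheory.Measure (Literature.MathematicalPhysics.KineticTheory.HeatConduction.PhaseSpace N), (Literature.MathematicalPhysics.KineticTheory.HeatConduction.pinnedChain ω₂ lam β γ).IsSteadyState N T_L T_R μ → (Literature.MathematicalPhysics.KineticTheory.HeatConduction.pinnedChain ω₂ lam β γ).IsSteadyState N T_L T_R ν → μ = ν) → ∀ μ : (N : ℕ) → ℝ → ℝ → MeasureTheory.Measure (Literature.MathematicalPhysics.KineticTheory.HeatConduction.PhaseSpace N), (∀ (N : ℕ) (T_L T_R : ℝ), 0 < T_L → 0 < T_R → (Literature.MathematicalPhysics.KineticTheory.HeatConduction.pinnedChain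 ω₂ lam β γ).IsSteadyState N T_L T_R (μ N T_L T_R)) → ∀ T : ℝ, 0 < T → ∀ (μT : MeasureTheory.Measure Literature.MathematicalPhysics.KineticTheory.HeatConduction.ChainConfig) (D : Literature.MathematicalPhysics.KineticTheory.HeatConduction.InfiniteChainDynamics (Literature.MathematicalPhysics.KineticTheory.HeatConduction.pinnedChain ω₂ lam β γ)), (Literature.MathematicalPhysics.KineticTheory.HeatConduction.pinnedChain ω₂ lam β γ).IsChainGibbsMeasure T μT → D.PreservesMeasure μT → D.HasGreenKubo μT T → ∃ Dn : ℕ → ℝ, (∀ N : ℕ, Filter.Tendsto (fun δ : ℝ => (Literature.MathematicalPhysics.KineticTheory.HeatConduction.pinnedChain ω₂ lam β γ).totalCurrent (μ N (T + δ / 2) (T - δ / 2)) / δ) (nhdsWithin 0 {(0 : ℝ)}ᶜ) (nhds (Dn N))) ∧ Filter.Tendsto Dn Filter.atTop (nhds (D.greenKuboConductivity μT T))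

/-- item stmt-AtomisticToContinuum-0705 · support · rank 4 · open · by planner
FINITE-N LINEAR RESPONSE EXISTS: for the pinned chain and every family of steady states, T > 0 and
N, δ ↦ totalCurrent(μ N (T+δ/2) (T−δ/2))/δ has a limit D as δ → 0, δ ≠ 0 (differentiability of the
NESS expectation of the polynomially bounded current in the bath temperatures at equilibrium;
Hairer–Majda arXiv:0909.4313 framework: hypoelliptic generator, Lyapunov function e^{θH}, smooth
parameter dependence). Vacuous unless steady states are unique (item (i)); with (i) it is
clause-(ii)-first-half of FouriersLawFor. -/
@[route_item "route-AtomisticToContinuum-FourierGreenKubo"]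
def FourierFiniteResponse : Prop :=
  ∀ ω₂ lam β γ : ℝ, 0 < ω₂ → 0 < lam → 0 < β → 0 < γ → ∀ μ : (N : ℕ) → ℝ → ℝ → MeasureTheory.Measure (Literature.MathematicalPhysics.KineticTheory.HeatConduction.PhaseSpace N), (∀ (N : ℕ) (T_L T_R : ℝ), 0 < T_L → 0 < T_R → (Literature.MathematicalPhysics.KineticTheory.HeatConduction.pinnedChain ω₂ lam β γ).IsSteadyState N T_L T_R (μ N T_L T_R)) → ∀ T : ℝ, 0 < T → ∀ N : ℕ, ∃ D : ℝ, Filter.Tendsto (fun δ : ℝ => (Literature.MathematicalPhysics.KineticTheory.HeatConduction.pinnedChain ω₂ lam β γ).totalCurrent (μ N (T + δ / 2) (T - δ / 2)) / δ) (nhdsWithin 0 {(0 : ℝ)}ᶜ) (nhds D)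

/-- item stmt-AtomisticToContinuum-0717 · support · rank 4 · closed · proved by Summit.AtomisticToContinuum.FouriersLaw.Theorems.FourierGreenKubo.finiteResponseOfUnique_holds (prover) · by planner
CONDITIONAL FORM OF 0705 (supersedes it as the prover target; refuters pool-5/g3-0: 0705 stand-alone
quantifies over EVERY steady-state family and is false-prone if weak steady states were non-unique):
assuming UNIQUENESS of weak steady states (IsSteadyState class) for pinnedChain at all N, T_L, T_R >
0, the finite-N linear-response limit D_N(T) = lim_{δ→0, δ≠0} totalCurrent(μ_{N,T+δ/2,T−δ/2})/δ
exists for every T > 0 and N. Content: differentiability at equilibrium of NESS expectations of the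
polynomial currents in the bath temperatures (ReyBellet2003 arXiv:math-ph/0303021 Rem 4.4 (51)–(56)
finite-volume Green–Kubo; HairerMajda2009 arXiv:0909.4313 Thm 2.3 framework — their SDE Thm 4.4
Assumption 5 fails here, so verify Assumptions 1–3 via CEHR2018 (2.5)/Carmona2007 Thm 1.1(iv)
weighted spectral gap). N = 0, 1: totalCurrent ≡ 0, D = 0. Together with 0706 gives 0705. -/
@[route_item "route-AtomisticToContinuum-FourierGreenKubo", crux]
def FourierFiniteResponseOfUnique : Prop :=
  ∀ ω₂ lam β γ : ℝ, 0 < ω₂ → 0 < lam → 0 < β → 0 < γ → (∀ (N : ℕ) (T_L T_R : ℝ), 0 < T_L → 0 < T_R → ∀ μ ν : MeasureTheory.Measure (Literature.MathematicalPhysics.KineticTheory.HeatConduction.PhaseSpace N), (Literature.MathematicalPhysics.KineticTheory.HeatConduction.pinnedChain ω₂ lam β γ).IsSteadyState N T_L T_R μ → (Literature.MathematicalPhysics.KineticTheory.HeatConduction.pinnedChain ω₂ lam β γ).IsSteadyState N T_L T_R ν → μ = ν) → ∀ μ : (N : ℕ) → ℝ → ℝ → MeasureTheory.Measure (Literature.MathematicalPhysics.KineticTheory.HeatConduction.PhaseSpace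 N), (∀ (N : ℕ) (T_L T_R : ℝ), 0 < T_L → 0 < T_R → (Literature.MathematicalPhysics.KineticTheory.HeatConduction.pinnedChain ω₂ lam β γ).IsSteadyState N T_L T_R (μ N T_L T_R)) → ∀ T : ℝ, 0 < T → ∀ N : ℕ, ∃ D : ℝ, Filter.Tendsto (fun δ : ℝ => (Literature.MathematicalPhysics.KineticTheory.HeatConduction.pinnedChain ω₂ lam β γ).totalCurrent (μ N (T + δ / 2) (T - δ / 2)) / δ) (nhdsWithin 0 {(0 : ℝ)}ᶜ) (nhds D)

/-- item stmt-AtomisticToContinuum-0706 · support · rank 5 · open · by planner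
NESS EXISTENCE AND UNIQUENESS for pinnedChain ω₂ lam β γ (all > 0), every N and T_L, T_R > 0, in the
weak Fokker–Planck class IsSteadyState (probability measure, ∫ L f dμ = 0 for f ∈ C_c^∞, bond
currents integrable). From CuneoEckmannHairerReyBellet2018 Thm 2.13 / Carmona2007 (unique invariant
measure of the Langevin SDE, conditions C1–C5 hold since interaction degree 4 ≥ pinning degree 4)
plus identification of weak stationary probability solutions with invariant measures
(hypoellipticity of L*, non-explosion). Degenerate N = 0, 1 included (N = 0: the point mass; N = 1:
single pinned oscillator with two OU baths). -/
@[route_item "route-AtomisticToContinuum-FourierGreenKubo"]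
def FourierNessExistsUnique : Prop :=
  ∀ ω₂ lam β γ : ℝ, 0 < ω₂ → 0 < lam → 0 < β → 0 < γ → ∀ (N : ℕ) (T_L T_R : ℝ), 0 < T_L → 0 < T_R → ∃ μ : MeasureTheory.Measure (Literature.MathematicalPhysics.KineticTheory.HeatConduction.PhaseSpace N), (Literature.MathematicalPhysics.KineticTheory.HeatConduction.pinnedChain ω₂ lam β γ).IsSteadyState N T_L T_R μ ∧ ∀ ν : MeasureTheory.Measure (Literature.MathematicalPhysics.KineticTheory.HeatConduction.PhaseSpace N), (Literature.MathematicalPhysics.KineticTheory.HeatConduction.pinnedChain ω₂ lam β γ).IsSteadyState N T_L T_R ν → ν = μ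

/-- item stmt-AtomisticToContinuum-0718 · support · rank 5 · closed · proved by Summit.AtomisticToContinuum.FouriersLaw.Theorems.GibbsSteadyState_proof (prover) · by planner
EQUILIBRIUM ANCHOR (refuter pool-5 on 0706: "a good Lean warm-up"; de-vacuifies IsSteadyState and
pins δ = 0 in 0705/0717): for pinnedChain ω₂ lam β γ (all > 0), every N and T > 0, the Gibbs measure
Z⁻¹ e^{−H_N(q,p)/T} d q d p (Z = ∫ e^{−H/T} ∈ (0,∞): H ≥ Σ p²/2 + ω₂ q²/2, polynomial growth) is a
weak steady state with T_L = T_R = T — probability ✓; ∫ L f dμ = 0 for f ∈ C_c^∞ by Liouville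
(Hamiltonian part: integrate by parts, {H, e^{−H/T}} = 0) and by ∫ (T ∂_p² f − p ∂_p f) e^{−p²/2T}
dp = 0 for the two Ornstein–Uhlenbeck bath terms; bond currents j_i = −½(p_i + p_{i+1})V′(q_{i+1} −
q_i) are integrable (Gaussian in p × e^{−(V+U)/T}) and have mean 0 (odd in p) ⇒ totalCurrent = 0.
Sources: BonettoLebowitzReyBellet2000 §4.1 (10)–(11) (Gibbs is stationary at equal temperatures);
folklore. -/
@[route_item "route-AtomisticToContinuum-FourierGreenKubo"]
def FourierGibbsSteadyState : Prop :=
  ∀ ω₂ lam β γ : ℝ, 0 < ω₂ → 0 < lam → 0 < β → 0 < γ → ∀ (N : ℕ) (T : ℝ), 0 < T → ∃ Z : ℝ, 0 < Z ∧ (Literature.MathematicalPhysics.KineticTheory.HeatConduction.pinnedChain ω₂ lam β γ).IsSteadyState N T T ((ENNReal.ofReal Z)⁻¹ • MeasureTheory.volume.withDensity (fun x => ENNReal.ofReal (Real.exp (-(Literature.MathematicalPhysics.KineticTheory.HeatConduction.pinnedChain ω₂ lam β γ).hamiltonian N x / T)))) ∧ (Literature.MathematicalPhysics.KineticTheory.HeatConduction.pinnedChain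 ω₂ lam β γ).totalCurrent ((ENNReal.ofReal Z)⁻¹ • MeasureTheory.volume.withDensity (fun x => ENNReal.ofReal (Real.exp (-(Literature.MathematicalPhysics.KineticTheory.HeatConduction.pinnedChain ω₂ lam β γ).hamiltonian N x / T)))) = 0

/-- item stmt-AtomisticToContinuum-0741 · support · rank 5 · closed · proved by Summit.AtomisticToContinuum.FouriersLaw.Theorems.nessUnique_proof (prover) · by planner
[crux] UNIQUENESS OF THE WEAK STEADY STATE (the half of stmt-0706 not covered by the landed fact
Literature.MathematicalPhysics.KineticTheory.HeatConduction.CuneoEckmannHairerReyBellet2018_pinnedChain,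
p3544): for pinnedChain ω₂ lam β γ (all > 0), every N and T_L, T_R > 0, any two measures in the weak
Fokker–Planck class IsSteadyState (probability, ∫ L f dμ = 0 for f ∈ C_c^∞, bond currents
integrable) coincide. Print: uniqueness of the INVARIANT MEASURE of the Langevin semigroup
(CuneoEckmannHairerReyBellet2018 Thm 2.13(1): C1, C2, CA; Carmona2007 Thm 1.1(iii)); the item
additionally needs 'weak stationary probability solution of L*μ = 0 ⇒ P_t-invariant' for this
hypoelliptic L with cubic drift (Echeverría 1982 well-posed martingale problem on C_c^∞ +
non-explosion via e^{θH}; Bogachev–Krylov–Röckner–Shaposhnikov 2015 Ch. 5 is non-degenerate only) —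
the FP-identification lemma is the formal crux. N = 0: PhaseSpace 0 is a point (unique probability
measure); N = 1: both baths on site 0, OU at temperature (T_L+T_R)/2. This is exactly the hypothesis
of FiniteResponse and ThermodynamicLimit and, with the fact, gives clause (i) of FouriersLawFor. -/
@[route_item "route-AtomisticToContinuum-FourierGreenKubo", crux]
def NessUnique : Prop :=
  ∀ ω₂ lam β γ : ℝ, 0 < ω₂ → 0 < lam → 0 < β → 0 < γ → ∀ (N : ℕ) (T_L T_R : ℝ), 0 < T_L → 0 < T_R → ∀ μ ν : MeasureTheory.Measure (Literature.MathematicalPhysics.KineticTheory.HeatConduction.PhaseSpace N), (Literature.MathematicalPhysics.KineticTheory.HeatConduction.pinnedChain ω₂ lam β γ).IsSteadyState N T_L T_R μ → (Literature.MathematicalPhysics.KineticTheory.HeatConduction.pinnedChain ω₂ lam β γ).IsSteadyState N T_L T_R ν → μ = ν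

/-- `NessUnique` holds: proved by `Summit.AtomisticToContinuum.FouriersLaw.Theorems.nessUnique_proof`. -/
theorem NessUnique_holds : NessUnique := _root_.Summit.AtomisticToContinuum.FouriersLaw.Theorems.nessUnique_proof

/-- item stmt-AtomisticToContinuum-0743 · support · rank 9 · closed · proved by Summit.AtomisticToContinuum.FouriersLaw.Theorems.InfiniteVolumeSetup.infiniteVolumeSetup_proof (prover) · by planner
[support] INFINITE-VOLUME SET-UP, split off GreenKubo on refuters' advice (g12-1/3/4: hidden
infrastructure load): for pinnedChain (all parameters > 0) and T > 0 there is a DLR Gibbs state μ_T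
(IsChainGibbsMeasure: existence via the 1-D transfer operator e^{-U/2T}e^{-V(q′−q)/T}e^{-U/2T},
Hilbert–Schmidt since U ≥ ω₂q²/2, or superstability/tightness) and an InfiniteChainDynamics D with
D.PreservesMeasure μ_T (μ_T-a.e. carrier, every φ_t measurable and measure preserving; requires a
carrier on which solutions are UNIQUE — LanfordLebowitzLieb1977 Thm 3 gives a.e. existence only, Thm
1/A4 fails for quartic V, Thm 2/4 uniqueness and invariance of μ_T under the infinite flow are not
vendored; nearest print for quartic U+V: Buttà–Caglioti–Di Ruzza–Marchioro 2007
doi:10.1007/s10955-007-9278-0, Marchioro–Pellegrinotti–Pulvirenti 1981). Print-level known modulo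
assembling these; a prerequisite of any GreenKubo witness. -/
@[route_item "route-AtomisticToContinuum-FourierGreenKubo"]
def InfiniteVolumeSetup : Prop :=
  ∀ ω₂ lam β γ : ℝ, 0 < ω₂ → 0 < lam → 0 < β → 0 < γ → ∀ T : ℝ, 0 < T → ∃ μ : MeasureTheory.Measure Literature.MathematicalPhysics.KineticTheory.HeatConduction.ChainConfig, (Literature.MathematicalPhysics.KineticTheory.HeatConduction.pinnedChain ω₂ lam β γ).IsChainGibbsMeasure T μ ∧ ∃ D : Literature.MathematicalPhysics.KineticTheory.HeatConduction.InfiniteChainDynamics (Literature.MathematicalPhysics.KineticTheory.HeatConduction.pinnedChain ω₂ lam β γ), D.PreservesMeasure μ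

/-- item stmt-AtomisticToContinuum-14144 · support · rank 9 · open · by planner
[support] [glue] TARGET REACHABILITY (route-choice 2026-08-16, option (a) of the gate hold
`route.target-unreachable`): the two ranked cruxes imply the rev-1 target frame — FourierGreenKubo →
ThermodynamicLimit → FourierGkThesis. Bookkeeping, provable now in one line: FourierGkThesis (= (i)
NESS exists-unique → (iii) Green–Kubo pair exists → (ii)+(iv) in the ∀(μ_T, D) form of FourierDNToGK
→ FouriersLaw; syntactically the same term as Assembly2) holds OUTRIGHT, being token for token the
type of the landed theorem
Literature.HeatConduction.fouriersLaw_of_ness_greenKubo_thermodynamicLimit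
(Summits/AtomisticToContinuum/FouriersLaw/Theorems/FourierGreenKuboAssembly.lean; `example :
FourierGkThesis := Literature.HeatConduction.fouriersLaw_of_ness_greenKubo_thermodynamicLimit`
elaborates, planner Sketch.lean rc0 2026-08-16), so `fun _ _ =>
Literature.HeatConduction.fouriersLaw_of_ness_greenKubo_thermodynamicLimit` proves this item and
`theorem … : FourierGkThesis :=
Literature.HeatConduction.fouriersLaw_of_ness_greenKubo_thermodynamicLimit` closes the target
itself. The route's deciding theorem `closes` (FourierGreenKubo, NessUnique,
FourierFiniteResponseOfUnique, ThermodynamicLimit ⊢ Fo -/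
@[route_item "route-AtomisticToContinuum-FourierGreenKubo"]
def FourierGkThesisOfCruxes : Prop :=
  FourierGreenKubo → ThermodynamicLimit → FourierGkThesis

/-- item stmt-AtomisticToContinuum-0702 · assembly · rank 1 · closed · proved by Literature.HeatConduction.fouriersLaw_of_steadyState_and_linearResponse (refuter) · by planner
Assembly (formal shadow): clause (i) for all parameters, and clause (ii) of FouriersLawFor for all
parameters (∃ κ > 0, ∀ steady-state families, ∀ T > 0, ∃ D, finite-N response limits exist ∧ D_N → κ
T), together give FouriersLaw (pure unfolding of FouriersLawFor/FouriersLaw). The route supplies the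
second hypothesis from (ii)–(iv) with κ = κ_GK. -/
@[route_item "route-AtomisticToContinuum-FourierGreenKubo"]
def Assembly : Prop :=
  (∀ ω₂ lam β γ : ℝ, 0 < ω₂ → 0 < lam → 0 < β → 0 < γ → ∀ (N : ℕ) (T_L T_R : ℝ), 0 < T_L → 0 < T_R → ∃ μ : MeasureTheory.Measure (Literature.MathematicalPhysics.KineticTheory.HeatConduction.PhaseSpace N), (Literature.MathematicalPhysics.KineticTheory.HeatConduction.pinnedChain ω₂ lam β γ).IsSteadyState N T_L T_R μ ∧ ∀ ν : MeasureTheory.Measure (Literature.MathematicalPhysics.KineticTheory.HeatConduction.PhaseSpace N), (Literature.MathematicalPhysics.KineticTheory.HeatConduction.pinnedChain ω₂ lam β γ).IsSteadyState N T_L T_R ν → ν = μ) → (∀ ω₂ lam β γ : ℝ, 0 < ω₂ → 0 < lam → 0 < β → 0 < γ → ∃ κ : ℝ → ℝ, (∀ T, 0 < T → 0 < κ T) ∧ ∀ μ : (N : ℕ) → ℝ → ℝ → MeasureTheory.Measure (Literature.MathematicalPhysics.KineticTheory.HeatConduction.PhaseSpace N), (∀ (N : ℕ) (T_L T_R : ℝ),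 0 < T_L → 0 < T_R → (Literature.MathematicalPhysics.KineticTheory.HeatConduction.pinnedChain ω₂ lam β γ).IsSteadyState N T_L T_R (μ N T_L T_R)) → ∀ T : ℝ, 0 < T → ∃ D : ℕ → ℝ, (∀ N : ℕ, Filter.Tendsto (fun δ : ℝ => (Literature.MathematicalPhysics.KineticTheory.HeatConduction.pinnedChain ω₂ lam β γ).totalCurrent (μ N (T + δ / 2) (T - δ / 2)) / δ) (nhdsWithin 0 {(0 : ℝ)}ᶜ) (nhds (D N))) ∧ Filter.Tendsto D Filter.atTop (nhds (κ T))) → Literature.MathematicalPhysics.KineticTheory.HeatConduction.FouriersLaw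

/-- `Assembly` holds: proved by `Literature.HeatConduction.fouriersLaw_of_steadyState_and_linearResponse`. -/
theorem Assembly_holds : Assembly := _root_.Literature.HeatConduction.fouriersLaw_of_steadyState_and_linearResponse

-- records of items no longer active in this route (dropped / restated):
-- earlier Assembly2 (stmt-AtomisticToContinuum-0736, dropped 2026-08-16T14:43:06Z): moot by None — (∀ ω₂ lam β γ : ℝ, 0 < ω₂ → 0 < lam → 0 < β → 0 < γ → ∀ (N : ℕ) (T_L T_R : ℝ), 0 < T_L → 0 < T_R → ∃ μ : MeasureTheory.Measure (Literature.MathematicalPhysics.KineticTheory.HeatConduction.PhaseSpace N), (Literature.MathematicalPhysics.KineticTheory.HeatConduction.pinnedChain ω₂ lam β γ).IsSteadyState N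
-- earlier Assembly3 (stmt-AtomisticToContinuum-0744, dropped 2026-08-16T14:43:06Z): moot by None — Literature.MathematicalPhysics.KineticTheory.HeatConduction.CuneoEckmannHairerReyBellet2018_pinnedChain → (∀ ω₂ lam β γ : ℝ, 0 < ω₂ → 0 < lam → 0 < β → 0 < γ → ∀ (N : ℕ) (T_L T_R : ℝ), 0 < T_L → 0 < T_R → ∀ μ ν : MeasureTheory.Measure (Literature.MathematicalPhysics.KineticTheory.HeatConduction.PhaseSp

/-! D-0027 §2.1 — DECIDING THEOREM (planner-authored via `route open/edit --closes-file`; by planner-rbadge-AtomisticToContinuum-FourierGre-7aae449e-g2-0 2026-08-15T16:15:06Z):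
its hypotheses are this route's items and its conclusion the sub-problem Statement (glue_lint), and it elaborates with this file. -/

@[closes "route-AtomisticToContinuum-FourierGreenKubo"] theorem closes (hGK : FourierGreenKubo) (hNU : NessUnique) (hFR : FourierFiniteResponseOfUnique)
    (hTL : ThermodynamicLimit) : _root_.FouriersLaw := by
  -- FouriersLaw = ∀ parameters > 0, FouriersLawFor (pinnedChain …) = clause (i) ∧ clause (ii).
  intro ω₂ lam β γ hω hl hβ hγ
  have huniq := hNU ω₂ lam β γ hω hl hβ hγ
  refine ⟨?_, ?_⟩
  · -- clause (i): existence from the LANDED theorem `pinnedChain_exists_isSteadyState`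
    -- (CuneoEckmannHairerReyBellet2018_pinnedChain_holds, all N incl. N = 0) + uniqueness = item NessUnique.
    intro N T_L T_R hL hR
    obtain ⟨μ, hμ⟩ :=
      Literature.MathematicalPhysics.KineticTheory.HeatConduction.pinnedChain_exists_isSteadyState hω hl hβ hγ N hL hR
    exact ⟨μ, hμ, fun ν hν => huniq N T_L T_R hL hR ν μ hν hμ⟩
  · -- clause (ii): for T > 0 feed the Green–Kubo pair of item FourierGreenKubo into item ThermodynamicLimit,
    -- choose its witnesses (μ_T, D_T) and put κ T := greenKuboConductivity D_T μ_T T (κ T := 1 for T ≤ 0);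
    -- κ T > 0 by HasGreenKubo.pos; for a steady-state family the D_N come from item
    -- FourierFiniteResponseOfUnique and the ThermodynamicLimit spec gives D_N → κ T.
    classical
    have hW := fun T (hT : 0 < T) =>
      hTL ω₂ lam β γ hω hl hβ hγ huniq T hT (hGK ω₂ lam β γ hω hl hβ hγ T hT)
    let μT := fun T (hT : 0 < T) => Classical.choose (hW T hT)
    have hμT := fun T (hT : 0 < T) => Classical.choose_spec (hW T hT)
    let DT := fun T (hT : 0 < T) => Classical.choose (hμT T hT)
    have hDT := fun T (hT : 0 < T) => Classical.choose_spec (hμT T hT)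
    refine ⟨fun T => if hT : 0 < T then (DT T hT).greenKuboConductivity (μT T hT) T else 1, ?_, ?_⟩
    · intro T hT
      simp only [dif_pos hT]
      exact (hDT T hT).2.2.1.pos
    · intro μ hμ T hT
      have hD := hFR ω₂ lam β γ hω hl hβ hγ huniq μ hμ T hT
      refine ⟨fun N => Classical.choose (hD N), fun N => Classical.choose_spec (hD N), ?_⟩
      simp only [dif_pos hT]
      exact (hDT T hT).2.2.2 μ hμ (fun N => Classical.choose (hD N)) (fun N => Classical.choose_spec (hD N))

end Summit.AtomisticToContinuum.FouriersLaw.Theses.FourierGreenKubo
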